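import Literature.AlgebraicGeometry.Smoothening.TorsionDrop
import Literature.AlgebraicGeometry.Smoothening.DilatationLattice
import Literature.AlgebraicGeometry.Smoothening.ConormalFibreKernel
import Literature.AlgebraicGeometry.Smoothening.KaehlerFibre
import Mathlib.RingTheory.Kaehler.Polynomial
import HarnessLib

/-!
# Néron's measure for the defect of smoothness drops under a dilatation (BLR Prop. 3.3/5)

Topic: `Literature/AlgebraicGeometry/Smoothening` (Bosch–Lütkebohmert–Raynaud, *Néron Models*,
§3.3, Prop. 5; M. Artin, *Néron Models*, Lemma (3.9) (Raynaud): "`l(x₁') < l(x')`"). This file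
proves the **pointwise computation** behind the key step of the smoothening process, in ring
form and from explicit generator data; the choice of the centre (BLR Lemma 3.3/4) that produces
such data is not made here.

**Setting.** `B` an `R`-algebra with `Ω[B⁄R]` finite free of rank `N` (the polynomial ring
`R[T₁, …, T_N]`, or a localization of it), `I ⊆ B`, `A = B/I` (`X = Spec A`), `ϖ ∈ R`, centre
generators `g₁, …, g_r ∈ B` (the centre of the dilatation is `V(ϖ, g) ∩ X_k`), and an
`A`-algebra `A'` playing the dilatation `A[(ϖ, ḡ)/ϖ]`: elements `zⱼ ∈ A'` with `ϖ zⱼ = ḡⱼ`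
(`hz`), `ϖ` regular on `A'` (`hreg`), `A' = A[z₁, …, z_r]` (`hadj`) — all satisfied by
`Dilatations.dilatation` — together with compatible points `a : A → S`, `a' : A' → S` with values
in a discrete valuation ring `S` in which `π = ϖ` is a uniformizer (ramification index one), and
the equality of generic ranks `rank_S a*Ω¹_{X/R} = rank_S a'*Ω¹_{X'/R}`
(`hrank`, supplied by `DefectGenericRank.finrank_tensor_kaehler_eq_of_subalgebra`).

**Generator data.** `p` equations `Fᵢ = ϖ f₀ᵢ + Σⱼ gⱼ fᵢⱼ ∈ I` ("divisible once by `ϖ` on the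
dilatation") and further equations `Q_k = ϖ² q₀₀ + ϖ Σ gⱼ q₀ⱼ + Σ gⱼ gₗ qⱼₗ ∈ I` (elements of
`I ∩ (ϖ, g)²`, "divisible twice"), generating `I` (`hgen`), and the smoothness of the centre at
the point in the form: the residues of the `dgⱼ(a)` modulo `π` are linearly independent (`hγ`).

**Theorem** (`neronDefect_dilatation_add_finrank_le`; `neronDefect_dilatation_add_le` for
`B = R[T₁, …, T_N]`):

  `δ(a') + N ≤ δ(a) + p + rank_S (a*Ω¹_{X/R})`.

In the smoothening process `p = N - rank_S(a*Ω¹) - ν` with `ν ≥ 1` the number of invariant factors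
of the torsion of `a*Ω¹` (when `X` is not smooth at `a`), so `δ(a') ≤ δ(a) - ν ≤ δ(a) - 1`.

**Proof** (BLR's computation, organized through `TorsionDrop`): with `F = S ⊗_B Ω[B⁄R]` (free of
rank `N`), `L = conormalSpan` (`δ(a) = ℓ(tors F/L)`, `ConormalFibreKernel`), `γⱼ = 1 ⊗ dgⱼ`,
`F' = (F ⊕ Sʳ)/⟨(-γⱼ, π eⱼ)⟩` and `D : F → F'` (`DilatationLattice`): the vectors
`ηᵢ = (1 ⊗ df₀ᵢ + Σ tⱼ (1 ⊗ dfᵢⱼ), (fᵢⱼ(a))ⱼ)` (`dividedVec`, `tⱼ = a'(zⱼ)`) and their degree-two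
analogues `η'_k` (`twiceDividedVec`) satisfy `π ηᵢ ≡ D(1 ⊗ dFᵢ)`, `π² η'_k ≡ D(1 ⊗ dQ_k)`
(`inl_tmul_D_eq`, `inl_tmul_D_eq₂` — Leibniz rule), so `TorsionDrop` gives
`ℓ(tors F'/L') + rank L ≤ δ(a) + p` for `L' = ⟨ηᵢ, η'_k⟩`; and `a'*Ω¹_{X'/R} = S ⊗_{A'} Ω[A'⁄R]` is a
quotient of `F'/L'` with torsion kernel (the map `Ψ : F ⊕ Sʳ → S ⊗_{A'} Ω[A'⁄R]`,
`(x, w) ↦ φ(x) + Σ wⱼ (1 ⊗ dzⱼ)`, kills the relations and the `η`'s because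
`hᵢ = f₀ᵢ + Σ zⱼ fᵢⱼ = 0` and `h'_k = 0` in `A'` by `ϖ`-regularity; it is onto because
`A' = A[z]`; ranks agree by `hrank`), whence `δ(a') ≤ ℓ(tors F'/L')`.

No named facts are introduced (D-0026); the source is followed in substance (Artin (3.9)(f):
"Write `f(pz, y) = p² g(z, y)`. Then `p ∂g/∂z = ∂f/∂x`, which shows that `l` decreases by
blowing-up"), with BLR's intrinsic `δ` in place of Artin's minors.

## References

* S. Bosch, W. Lütkebohmert, M. Raynaud, *Néron Models*, Springer 1990, §3.3, Lemma 4 and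
  Prop. 5. [BLRNeronModels1990] (Not held; numbers only.)
* M. Artin, *Néron Models*, in: G. Cornell, J. H. Silverman (eds.), *Arithmetic Geometry*,
  Springer 1986, Lemma (3.9) and its proof (pp. 226–227). [Artin1986NeronModels]
-/

noncomputable section

open scoped TensorProduct
open KaehlerDifferential MvPolynomial

namespace Literature.AlgebraicGeometry.Smoothening

universe u

section Setting

variable {R : Type u} [CommRing R] (ϖ : R) {B : Type u} [CommRing B] [Algebra R B]
  (S : Type u) [CommRing S] [Algebra R S] [Algebra B S]
  [IsScalarTower R B S]
  {r : ℕ} (g : Fin r → B) (t : Fin r → S)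
  (hgt : ∀ j, algebraMap B S (g j) = algebraMap R S ϖ * t j)


omit [Algebra R S] [IsScalarTower R (B) S] in
/-- `1 ⊗ (b • ω) = b(a) • (1 ⊗ ω)`. [folklore] -/
theorem one_tmul_smul (b : B) (ω : Ω[B⁄R]) :
    (1 : S) ⊗ₜ[B] (b • ω) = algebraMap (B) S b • ((1 : S) ⊗ₜ[B] ω) := by
  rw [TensorProduct.tmul_smul, algebraMap_smul]

/-- The vectors `γⱼ = 1 ⊗ dgⱼ ∈ S ⊗_B Ω[B⁄R]` of the centre generators. [folklore] -/
def centreVec : Fin r → S ⊗[B] Ω[B⁄R] := fun j => (1 : S) ⊗ₜ[B] D R (B) (g j)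

variable (R) in
/-- The once-divided test vector `η = (1 ⊗ df₀ + Σ tⱼ (1 ⊗ dfⱼ), (fⱼ(a))ⱼ) ∈ F ⊕ Sʳ` attached to
an equation `ϖ f₀ + Σ gⱼ fⱼ` (the differential at `a'` of `f₀ + Σ Zⱼ fⱼ`). [folklore] -/
def dividedVec (f0 : B) (fc : Fin r → B) : (S ⊗[B] Ω[B⁄R]) × (Fin r → S) :=
  ((1 : S) ⊗ₜ[B] D R (B) f0 + ∑ j, t j • ((1 : S) ⊗ₜ[B] D R (B) (fc j)),
    fun j => algebraMap (B) S (fc j))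

include hgt in
/-- **`π η ≡ D(1 ⊗ d(ϖ f₀ + Σ gⱼ fⱼ))`** modulo the relation vectors `ρⱼ = (-γⱼ, π eⱼ)`:
`(1 ⊗ d(ϖ f₀ + Σ gⱼ fⱼ), 0) = π η - Σⱼ fⱼ(a) ρⱼ` (Leibniz rule; `gⱼ(a) = π tⱼ`).
[cite: Artin1986NeronModels, proof of Lemma (3.9), step (f) (p. 227)] -/
theorem inl_tmul_D_eq (f0 : B) (fc : Fin r → B) :
    (((1 : S) ⊗ₜ[B] D R (B) (algebraMap R B ϖ * f0 + ∑ j, g j * fc j), 0) : (S ⊗[B] Ω[B⁄R]) × (Fin r → S)) =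
      algebraMap R S ϖ • dividedVec R S t f0 fc -
        ∑ j, algebraMap (B) S (fc j) •
          ((-(centreVec S g j), Pi.single j (algebraMap R S ϖ)) : (S ⊗[B] Ω[B⁄R]) × (Fin r → S)) := by
  classical
  have hDC : D R B (algebraMap R B ϖ) = 0 := Derivation.map_algebraMap _ ϖ
  have hC : algebraMap B S (algebraMap R B ϖ) = algebraMap R S ϖ :=
    (IsScalarTower.algebraMap_apply R B S ϖ).symm
  refine Prod.ext ?_ ?_
  · -- first component
    simp only [Prod.fst_sub, Prod.fst_sum, Prod.smul_fst, dividedVec, centreVec,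
      map_add, map_sum, Derivation.leibniz, hDC, smul_zero, add_zero, TensorProduct.tmul_add,
      TensorProduct.tmul_sum, one_tmul_smul, hgt, hC, smul_add, Finset.smul_sum, smul_neg,
      mul_smul, sub_neg_eq_add, Finset.sum_neg_distrib, Finset.sum_add_distrib, add_assoc]
  · funext j
    simp only [Prod.snd_sub, Prod.snd_sum, Prod.smul_snd, dividedVec, Pi.sub_apply,
      Finset.sum_apply, Pi.smul_apply, Pi.single_apply, smul_eq_mul, mul_ite, mul_zero,
      Finset.sum_ite_eq, Finset.mem_univ, if_true, Pi.zero_apply]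
    ring

/-- Reindexing: `Σⱼ Σₗ aⱼₗ (tⱼ wₗ + tₗ wⱼ) = Σₘ (Σₗ tₗ (aₗₘ + aₘₗ)) wₘ`. [folklore] -/
theorem sum_sum_smul_add_smul {M : Type*} [AddCommGroup M] [Module S M] (a : Fin r → Fin r → S)
    (w : Fin r → M) :
    (∑ j, ∑ l, a j l • (t j • w l + t l • w j)) =
      ∑ m, (∑ l, t l * (a l m + a m l)) • w m := by
  simp only [smul_add, Finset.sum_add_distrib, ← mul_smul, mul_add, add_smul, Finset.sum_smul]
  rw [Finset.sum_comm]
  congr 1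
  · refine Finset.sum_congr rfl fun m _ => Finset.sum_congr rfl fun l _ => ?_
    rw [mul_comm]
  · refine Finset.sum_congr rfl fun m _ => Finset.sum_congr rfl fun l _ => ?_
    rw [mul_comm]

variable (R) in
/-- The twice-divided test vector
`η' = (1 ⊗ dq₀₀ + Σ tⱼ (1 ⊗ dq₀ⱼ) + Σ tⱼ tₗ (1 ⊗ dqⱼₗ), (q₀ⱼ(a) + Σₗ tₗ (qₗⱼ(a) + qⱼₗ(a)))ⱼ)`
attached to an equation `ϖ² q₀₀ + ϖ Σ gⱼ q₀ⱼ + Σ gⱼ gₗ qⱼₗ` (the differential at `a'` of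
`q₀₀ + Σ Zⱼ q₀ⱼ + Σ Zⱼ Zₗ qⱼₗ`). [folklore] -/
def twiceDividedVec (q00 : B) (q0 : Fin r → B) (qq : Fin r → Fin r → B) :
    (S ⊗[B] Ω[B⁄R]) × (Fin r → S) :=
  ((1 : S) ⊗ₜ[B] D R (B) q00 + ∑ j, t j • ((1 : S) ⊗ₜ[B] D R (B) (q0 j)) +
      ∑ j, ∑ l, (t j * t l) • ((1 : S) ⊗ₜ[B] D R (B) (qq j l)),
    fun j => algebraMap (B) S (q0 j) +
      ∑ l, t l * (algebraMap (B) S (qq l j) + algebraMap (B) S (qq j l)))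

include hgt in
/-- **`π² η' ≡ D(1 ⊗ d(ϖ² q₀₀ + ϖ Σ gⱼ q₀ⱼ + Σ gⱼ gₗ qⱼₗ))`** modulo the `ρⱼ`:
`(1 ⊗ dq, 0) = π² η' - Σⱼ (π η'.2 j) ρⱼ`. [cite: Artin1986NeronModels, proof of Lemma (3.9), step (f) (p. 227)] -/
theorem inl_tmul_D_eq₂ (q00 : B) (q0 : Fin r → B) (qq : Fin r → Fin r → B) :
    (((1 : S) ⊗ₜ[B] D R (B) (algebraMap R B ϖ * algebraMap R B ϖ * q00 + ∑ j, algebraMap R B ϖ * g j * q0 j + ∑ j, ∑ l, g j * g l * qq j l),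
        0) : (S ⊗[B] Ω[B⁄R]) × (Fin r → S)) =
      (algebraMap R S ϖ * algebraMap R S ϖ) • twiceDividedVec R S t q00 q0 qq -
        ∑ j, (algebraMap R S ϖ * (twiceDividedVec R S t q00 q0 qq).2 j) •
          ((-(centreVec S g j), Pi.single j (algebraMap R S ϖ)) : (S ⊗[B] Ω[B⁄R]) × (Fin r → S)) := by
  classical
  have hDC : D R B (algebraMap R B ϖ) = 0 := Derivation.map_algebraMap _ ϖ
  have hC : algebraMap B S (algebraMap R B ϖ) = algebraMap R S ϖ :=
    (IsScalarTower.algebraMap_apply R B S ϖ).symm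
  set π := algebraMap R S ϖ with hπ
  refine Prod.ext ?_ ?_
  · have key := sum_sum_smul_add_smul S t (fun j l => algebraMap B S (qq j l) * π) (centreVec (R := R) S g)
    simp only [Prod.fst_sub, Prod.fst_sum, Prod.smul_fst, twiceDividedVec, centreVec,
      map_add, map_sum, Derivation.leibniz, hDC, smul_zero, add_zero,
      TensorProduct.tmul_add, TensorProduct.tmul_sum, one_tmul_smul, hgt, hC, smul_add,
      Finset.smul_sum, smul_neg, mul_smul, Finset.sum_add_distrib, add_assoc]
      at key ⊢
    rw [key]
    simp only [smul_smul, smul_add, add_smul, Finset.sum_add_distrib, Finset.sum_neg_distrib,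
      sub_neg_eq_add, Finset.mul_sum, mul_add]
    simp only [mul_comm, mul_assoc, mul_left_comm]
    abel
  · funext j
    simp only [Prod.snd_sub, Prod.snd_sum, Prod.smul_snd, twiceDividedVec, Pi.sub_apply,
      Finset.sum_apply, Pi.smul_apply, Pi.single_apply, smul_eq_mul, mul_ite, mul_zero,
      Finset.sum_ite_eq, Finset.mem_univ, if_true, Pi.zero_apply]
    ring


end Setting

section Aprime

variable {R : Type u} [CommRing R] (ϖ : R) {B : Type u} [CommRing B] [Algebra R B]
  (I : Ideal B)
  (A' : Type u) [CommRing A'] [Algebra R A'] [Algebra (B ⧸ I) A']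
  [IsScalarTower R (B ⧸ I) A']
  {r : ℕ} (g : Fin r → B) (z : Fin r → A')
  (hz : ∀ j, algebraMap R A' ϖ * z j =
    algebraMap (B ⧸ I) A' (Ideal.Quotient.mk I (g j)))
  (S : Type u) [CommRing S] [Algebra R S] [Algebra B S]
  [Algebra (B ⧸ I) S] [Algebra A' S]
  [IsScalarTower R B S]
  [IsScalarTower B (B ⧸ I) S]
  [IsScalarTower (B ⧸ I) A' S] [IsScalarTower R A' S]


variable (R) in
/-- The structure map `B → A → A'`. [folklore] -/
def toDil : B →ₐ[R] A' :=
  (IsScalarTower.toAlgHom R (B ⧸ I) A').comp (Ideal.Quotient.mkₐ R I)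

/-- `B → A'` through `A`. [folklore] -/
theorem toDil_apply (b : B) : toDil R I A' b = algebraMap (B ⧸ I) A' (Ideal.Quotient.mk I b) := rfl

omit [Algebra R S] [IsScalarTower R (B) S] [IsScalarTower R A' S] in
/-- The points are compatible: `a'(b'') = a(b)`. [folklore] -/
theorem algebraMap_toDil (b : B) : algebraMap A' S (toDil R I A' b) = algebraMap (B) S b := by
  rw [toDil_apply, ← IsScalarTower.algebraMap_apply, ← Ideal.Quotient.algebraMap_eq,
    ← IsScalarTower.algebraMap_apply]

/-- `I` dies in `A'`. [folklore] -/
theorem toDil_eq_zero {f : B} (hf : f ∈ I) : toDil R I A' f = 0 := by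
  rw [toDil_apply, Ideal.Quotient.eq_zero_iff_mem.mpr hf, map_zero]

/-- `algebraMap R B ϖ ↦ ϖ`. [folklore] -/
theorem toDil_algebraMap : toDil R I A' (algebraMap R B ϖ) = algebraMap R A' ϖ :=
  (toDil R I A').commutes ϖ

include hz in
/-- `gⱼ ↦ ϖ zⱼ`. [folklore] -/
theorem toDil_g (j : Fin r) : toDil R I A' (g j) = algebraMap R A' ϖ * z j := by
  rw [toDil_apply, ← hz]

variable (R) in
/-- `φ : S ⊗_B Ω[B⁄R] → S ⊗_{A'} Ω[A'⁄R]`, `1 ⊗ db ↦ 1 ⊗ d b''` (the fibre map along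
`B → A → A'`). [folklore] -/
def phiMap : S ⊗[B] Ω[B⁄R] →ₗ[S] S ⊗[A'] Ω[A'⁄R] :=
  fibreMap R (B ⧸ I) A' S ∘ₗ fibreMap R (B) (B ⧸ I) S

omit [Algebra R S] [IsScalarTower R (B) S] [IsScalarTower R A' S] in
/-- `φ (s ⊗ db) = s ⊗ d b''`. [folklore] -/
theorem phiMap_tmul_D (s : S) (b : B) :
    phiMap R I A' S (s ⊗ₜ[B] D R (B) b) = s ⊗ₜ[A'] D R A' (toDil R I A' b) := by
  simp only [phiMap, LinearMap.comp_apply, fibreMap_tmul, KaehlerDifferential.map_D, toDil_apply,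
    Ideal.Quotient.algebraMap_eq]

variable (R) in
/-- `ψ : Sʳ → S ⊗_{A'} Ω[A'⁄R]`, `w ↦ Σ wⱼ (1 ⊗ dzⱼ)`. [folklore] -/
def psiMap : (Fin r → S) →ₗ[S] S ⊗[A'] Ω[A'⁄R] :=
  Fintype.linearCombination S fun j => (1 : S) ⊗ₜ[A'] D R A' (z j)

variable (R) in
/-- `Ψ = φ ⊕ ψ : F ⊕ Sʳ → S ⊗_{A'} Ω[A'⁄R]` (a presentation of `a'*Ω¹_{X'/R}` by the
differentials of `B[Z₁, …, Z_r] → A'`). [folklore] -/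
def PsiMap : (S ⊗[B] Ω[B⁄R]) × (Fin r → S) →ₗ[S] S ⊗[A'] Ω[A'⁄R] :=
  (phiMap R I A' S).coprod (psiMap R A' z S)

omit [Algebra R S] [IsScalarTower R (B) S] [IsScalarTower R A' S] in
/-- `Ψ (x, w) = φ x + Σ wⱼ (1 ⊗ dzⱼ)`. [folklore] -/
theorem PsiMap_apply (x : S ⊗[B] Ω[B⁄R]) (w : Fin r → S) :
    PsiMap R I A' z S (x, w) = phiMap R I A' S x + ∑ j, w j • ((1 : S) ⊗ₜ[A'] D R A' (z j)) := by
  simp [PsiMap, psiMap, Fintype.linearCombination_apply]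

omit [Algebra R S] [IsScalarTower R A' S] in
/-- `1 ⊗ (x • ω) = x(a') • (1 ⊗ ω)` on `A'`. [folklore] -/
theorem one_tmul_smul' (x : A') (ω : Ω[A'⁄R]) :
    (1 : S) ⊗ₜ[A'] (x • ω) = algebraMap A' S x • ((1 : S) ⊗ₜ[A'] ω) := by
  rw [TensorProduct.tmul_smul, algebraMap_smul]

omit [IsScalarTower R (B) S] in
include hz in
/-- **`Ψ` kills the relation vectors `ρⱼ = (-γⱼ, π eⱼ)`** (`d ḡⱼ = ϖ dzⱼ` in `Ω[A'⁄R]`). [folklore] -/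
theorem PsiMap_rel (j : Fin r) :
    PsiMap R I A' z S (-(centreVec S g j), Pi.single j (algebraMap R S ϖ)) = 0 := by
  classical
  have hDϖ : D R A' (algebraMap R A' ϖ) = 0 := Derivation.map_algebraMap _ ϖ
  have hπ : algebraMap A' S (algebraMap R A' ϖ) = algebraMap R S ϖ :=
    (IsScalarTower.algebraMap_apply R A' S ϖ).symm
  rw [PsiMap_apply, centreVec, map_neg, phiMap_tmul_D, toDil_g ϖ I A' g z hz, Derivation.leibniz,
    hDϖ, smul_zero, add_zero, one_tmul_smul', hπ]
  simp [Pi.single_apply]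

omit [Algebra R S] [IsScalarTower R (B) S] [IsScalarTower R A' S] in
/-- **`Ψ(η) = 1 ⊗ dh`** with `h = f₀'' + Σ zⱼ fⱼ''` (the once-divided equation on `A'`). [folklore] -/
theorem PsiMap_dividedVec (f0 : B) (fc : Fin r → B) :
    PsiMap R I A' z S (dividedVec R S (fun j => algebraMap A' S (z j)) f0 fc) =
      (1 : S) ⊗ₜ[A'] D R A' (toDil R I A' f0 + ∑ j, z j * toDil R I A' (fc j)) := by
  simp only [PsiMap_apply, dividedVec, map_add, map_sum, map_smul, phiMap_tmul_D,
    Derivation.leibniz, TensorProduct.tmul_add, TensorProduct.tmul_sum, one_tmul_smul',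
    algebraMap_toDil, Finset.sum_add_distrib, add_assoc]

include hz in
/-- **`h = f₀'' + Σ zⱼ fⱼ'' = 0` in `A'`** when `ϖ` is regular on `A'` and `ϖ f₀ + Σ gⱼ fⱼ ∈ I`
(`ϖ h` is the image of the equation). [cite: Artin1986NeronModels, proof of Lemma (3.9), step (f) (p. 227)] -/
theorem dividedRel_eq_zero (hreg : IsSMulRegular A' (algebraMap R A' ϖ)) (f0 : B) (fc : Fin r → B)
    (hf : algebraMap R B ϖ * f0 + ∑ j, g j * fc j ∈ I) :
    toDil R I A' f0 + ∑ j, z j * toDil R I A' (fc j) = 0 := by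
  apply hreg
  change algebraMap R A' ϖ • (toDil R I A' f0 + ∑ j, z j * toDil R I A' (fc j)) = algebraMap R A' ϖ • 0
  rw [smul_zero, smul_eq_mul, mul_add, Finset.mul_sum]
  have h1 : ∀ j, algebraMap R A' ϖ * (z j * toDil R I A' (fc j)) = toDil R I A' (g j) * toDil R I A' (fc j) :=
    fun j => by rw [← mul_assoc, ← toDil_g ϖ I A' g z hz j]
  simp only [h1]
  simp only [← toDil_algebraMap ϖ I A', ← map_mul, ← map_sum, ← map_add]
  exact toDil_eq_zero I A' hf

omit [Algebra R S] [IsScalarTower R (B) S] [IsScalarTower R A' S] in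
/-- **`Ψ(η') = 1 ⊗ dh'`** with `h' = q₀₀'' + Σ zⱼ q₀ⱼ'' + Σ zⱼ zₗ qⱼₗ''`. [folklore] -/
theorem PsiMap_twiceDividedVec (q00 : B) (q0 : Fin r → B) (qq : Fin r → Fin r → B) :
    PsiMap R I A' z S (twiceDividedVec R S (fun j => algebraMap A' S (z j)) q00 q0 qq) =
      (1 : S) ⊗ₜ[A'] D R A' (toDil R I A' q00 + ∑ j, z j * toDil R I A' (q0 j) +
        ∑ j, ∑ l, z j * z l * toDil R I A' (qq j l)) := by
  have key := sum_sum_smul_add_smul S (fun j => algebraMap A' S (z j))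
    (fun j l => algebraMap (B) S (qq j l)) (fun j => (1 : S) ⊗ₜ[A'] D R A' (z j))
  simp only [PsiMap_apply, twiceDividedVec, map_add, map_sum, map_smul, map_mul, phiMap_tmul_D,
    Derivation.leibniz, TensorProduct.tmul_add, TensorProduct.tmul_sum, one_tmul_smul',
    algebraMap_toDil, Finset.sum_add_distrib, add_smul] at key ⊢
  rw [← key]
  abel

include hz in
/-- **`h' = 0` in `A'`** (`ϖ² h'` is the image of the equation; `ϖ` regular). [folklore] -/
theorem twiceDividedRel_eq_zero (hreg : IsSMulRegular A' (algebraMap R A' ϖ)) (q00 : B)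
    (q0 : Fin r → B) (qq : Fin r → Fin r → B)
    (hq : algebraMap R B ϖ * algebraMap R B ϖ * q00 + ∑ j, algebraMap R B ϖ * g j * q0 j + ∑ j, ∑ l, g j * g l * qq j l ∈ I) :
    toDil R I A' q00 + ∑ j, z j * toDil R I A' (q0 j) + ∑ j, ∑ l, z j * z l * toDil R I A' (qq j l) = 0 := by
  apply hreg; apply hreg
  change algebraMap R A' ϖ • algebraMap R A' ϖ • (toDil R I A' q00 + ∑ j, z j * toDil R I A' (q0 j) +
    ∑ j, ∑ l, z j * z l * toDil R I A' (qq j l)) = algebraMap R A' ϖ • algebraMap R A' ϖ • 0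
  rw [smul_zero, smul_zero, smul_eq_mul, smul_eq_mul, ← toDil_eq_zero (R := R) I A' hq]
  simp only [map_add, map_sum, map_mul, toDil_algebraMap ϖ I A', toDil_g ϖ I A' g z hz, mul_add,
    Finset.mul_sum]
  congr 1
  · congr 1
    · ring
    · exact Finset.sum_congr rfl fun j _ => by ring
  · exact Finset.sum_congr rfl fun j _ => Finset.sum_congr rfl fun l _ => by ring

omit [Algebra R S] [IsScalarTower R (B) S] [IsScalarTower R A' S] in
/-- **`Ψ` is surjective** when `A'` is generated over `A` by the `zⱼ` (`Ω[A'⁄R]` is then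
generated by `dA` and the `dzⱼ`). [folklore] -/
theorem PsiMap_surjective (hadj : Algebra.adjoin (B ⧸ I) (Set.range z) = ⊤) :
    Function.Surjective (PsiMap R I A' z S) := by
  classical
  have hP : ∀ x : A', (1 : S) ⊗ₜ[A'] D R A' x ∈ LinearMap.range (PsiMap R I A' z S) := by
    intro x
    have hx : x ∈ Algebra.adjoin (B ⧸ I) (Set.range z) := by rw [hadj]; trivial
    induction hx using Algebra.adjoin_induction with
    | mem x hx =>
      obtain ⟨j, rfl⟩ := hx
      refine ⟨(0, Pi.single j 1), ?_⟩
      rw [PsiMap_apply, map_zero, zero_add]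
      simp [Pi.single_apply]
    | algebraMap a =>
      obtain ⟨b, rfl⟩ := Ideal.Quotient.mk_surjective a
      refine ⟨((1 : S) ⊗ₜ[B] D R (B) b, 0), ?_⟩
      rw [PsiMap_apply, phiMap_tmul_D, toDil_apply]
      simp
    | add x y _ _ hx hy => rw [map_add, TensorProduct.tmul_add]; exact add_mem hx hy
    | mul x y _ _ hx hy =>
      rw [Derivation.leibniz, TensorProduct.tmul_add, one_tmul_smul', one_tmul_smul']
      exact add_mem (Submodule.smul_mem _ _ hy) (Submodule.smul_mem _ _ hx)
  rw [← LinearMap.range_eq_top, eq_top_iff]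
  rintro m -
  induction m using TensorProduct.induction_on with
  | zero => exact zero_mem _
  | add a b ha hb => exact add_mem ha hb
  | tmul s ω =>
    have hs : s ⊗ₜ[A'] ω = s • ((1 : S) ⊗ₜ[A'] ω) := by
      rw [TensorProduct.smul_tmul', smul_eq_mul, mul_one]
    rw [hs]
    refine Submodule.smul_mem _ _ ?_
    clear hs
    have hω : ω ∈ Submodule.span A' (Set.range (D R A')) := by
      rw [KaehlerDifferential.span_range_derivation]; trivial
    induction hω using Submodule.span_induction with
    | mem _ h => obtain ⟨x, rfl⟩ := h; exact hP x
    | zero => rw [TensorProduct.tmul_zero]; exact zero_mem _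
    | add _ _ _ _ h1 h2 => rw [TensorProduct.tmul_add]; exact add_mem h1 h2
    | smul a ω _ h => rw [one_tmul_smul']; exact Submodule.smul_mem _ _ h

end Aprime

section Assembly

variable {R : Type u} [CommRing R] (ϖ : R) {B : Type u} [CommRing B] [Algebra R B]
  (I : Ideal B)
  (A' : Type u) [CommRing A'] [Algebra R A'] [Algebra (B ⧸ I) A']
  [IsScalarTower R (B ⧸ I) A']
  {r : ℕ} (g : Fin r → B) (z : Fin r → A')
  (hz : ∀ j, algebraMap R A' ϖ * z j =
    algebraMap (B ⧸ I) A' (Ideal.Quotient.mk I (g j)))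
  (S : Type u) [CommRing S] [IsDomain S] [IsDiscreteValuationRing S] [Algebra R S]
  [Algebra B S]
  [Algebra (B ⧸ I) S] [Algebra A' S]
  [IsScalarTower R B S]
  [IsScalarTower B (B ⧸ I) S]
  [IsScalarTower R (B ⧸ I) S]
  [IsScalarTower (B ⧸ I) A' S] [IsScalarTower R A' S]


include hz in
omit [IsDomain S] [IsDiscreteValuationRing S] [IsScalarTower R (B ⧸ I) S]
  [IsScalarTower R (B) S] in
/-- `gⱼ(a) = π tⱼ` with `tⱼ = a'(zⱼ)`. [folklore] -/
theorem algebraMap_g_eq (j : Fin r) :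
    algebraMap (B) S (g j) = algebraMap R S ϖ * algebraMap A' S (z j) := by
  rw [← algebraMap_toDil (R := R) I A' S, toDil_g ϖ I A' g z hz, map_mul, ← IsScalarTower.algebraMap_apply]

omit [Algebra R S] [IsScalarTower R B S] in
/-- `rank_S (S ⊗_B Ω[B⁄R]) = rank_B Ω[B⁄R]` for `Ω[B⁄R]` free. [folklore] -/
theorem finrank_tensor_kaehler_eq [Module.Free B Ω[B⁄R]] :
    Module.finrank S (S ⊗[B] Ω[B⁄R]) = Module.finrank B Ω[B⁄R] := by
  haveI : Nontrivial B := (algebraMap B S).domain_nontrivial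
  rw [Module.finrank_baseChange]

omit [IsScalarTower R B S] in
/-- `rank_S (S ⊗_B Ω[B⁄R]) = N` for `B = R[T₁, …, T_N]`. [folklore] -/
theorem finrank_tensor_kaehler_mvPolynomial {N : ℕ} [Algebra (MvPolynomial (Fin N) R) S] :
    Module.finrank S (S ⊗[MvPolynomial (Fin N) R] Ω[MvPolynomial (Fin N) R⁄R]) = N := by
  haveI : Nontrivial R := (algebraMap R S).domain_nontrivial
  haveI : Module.Free (MvPolynomial (Fin N) R) Ω[MvPolynomial (Fin N) R⁄R] :=
    Module.Free.of_basis (KaehlerDifferential.mvPolynomialBasis R (Fin N))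
  rw [Module.finrank_baseChange,
    Module.finrank_eq_card_basis (KaehlerDifferential.mvPolynomialBasis R (Fin N)), Fintype.card_fin]

include hz in
set_option maxHeartbeats 800000 in
/-- **BLR Prop. 3.3/5 (pointwise, from generator data): Néron's measure for the defect of
smoothness drops under the dilatation.** With the notation of the module docstring (for any
`R`-algebra `B` with `Ω[B⁄R]` finite free, `N := rank_B Ω[B⁄R]`, e.g. a polynomial ring; the
equations need only generate `I` up to multiplication by elements of a multiplicative set `U`
that become units at the point, i.e. on a neighbourhood of the point):
`δ(a') + N ≤ δ(a) + p + rank_S (S ⊗_A Ω[A⁄R])`, where `p` is the number of once-divided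
equations; in the smoothening process `p + rank_S(a*Ω¹) ≤ N - 1` when `X` is not smooth at `a`,
so `δ(a') ≤ δ(a) - 1` (Artin: "`l` decreases by blowing-up").
[cite: Artin1986NeronModels, Lemma (3.9) (p. 227)] -/
theorem neronDefect_dilatation_add_finrank_le [Module.Free B Ω[B⁄R]] [Module.Finite B Ω[B⁄R]]
    (hπ : Irreducible (algebraMap R S ϖ))
    (hreg : IsSMulRegular A' (algebraMap R A' ϖ))
    (hadj : Algebra.adjoin (B ⧸ I) (Set.range z) = ⊤)
    (hrank : Module.finrank S (S ⊗[B ⧸ I] Ω[(B ⧸ I)⁄R]) = Module.finrank S (S ⊗[A'] Ω[A'⁄R]))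
    (hγ : ∀ c : Fin r → S, (∃ y : S ⊗[B] Ω[B⁄R], ∑ j, c j • centreVec S g j = algebraMap R S ϖ • y) →
      ∀ j, algebraMap R S ϖ ∣ c j)
    {p : ℕ} (f0 : Fin p → B) (fc : Fin p → Fin r → B)
    (hf : ∀ i, algebraMap R B ϖ * f0 i + ∑ j, g j * fc i j ∈ I)
    {κ : Type} [Fintype κ] (q00 : κ → B) (q0 : κ → Fin r → B) (qq : κ → Fin r → Fin r → B)
    (hq : ∀ k, algebraMap R B ϖ * algebraMap R B ϖ * q00 k + ∑ j, algebraMap R B ϖ * g j * q0 k j + ∑ j, ∑ l, g j * g l * qq k j l ∈ I)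
    (U : Submonoid B) (hU : ∀ u ∈ U, IsUnit (algebraMap B S u))
    (hgen : ∀ f ∈ I, ∃ u ∈ U, u * f ∈
      Ideal.span (Set.range fun i => algebraMap R B ϖ * f0 i + ∑ j, g j * fc i j) ⊔
      Ideal.span (Set.range fun k =>
        algebraMap R B ϖ * algebraMap R B ϖ * q00 k + ∑ j, algebraMap R B ϖ * g j * q0 k j + ∑ j, ∑ l, g j * g l * qq k j l)) :
    neronDefect R A' S + Module.finrank B Ω[B⁄R] ≤
      neronDefect R (B ⧸ I) S + p + Module.finrank S (S ⊗[B ⧸ I] Ω[(B ⧸ I)⁄R]) := by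
  classical
  -- notation
  set N := Module.finrank B Ω[B⁄R] with hNdef
  set π : S := algebraMap R S ϖ with hπdef
  set t : Fin r → S := fun j => algebraMap A' S (z j) with htdef
  have hgt : ∀ j, algebraMap (B) S (g j) = π * t j := fun j => algebraMap_g_eq ϖ I A' g z hz S j
  set F := S ⊗[B] Ω[B⁄R] with hFdef
  set γ : Fin r → S ⊗[B] Ω[B⁄R] := centreVec S g with hγdef
  set P := dilatationRelations γ π with hPdef
  set Dm := dilatationMap γ π with hDmdef
  haveI : Module.IsTorsionFree S ((F × (Fin r → S)) ⧸ P) := isTorsionFree_dilatationQuot γ hπ hγ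
  -- the test vectors
  set F1 : Fin p → B := fun i => algebraMap R B ϖ * f0 i + ∑ j, g j * fc i j with hF1
  set Q2 : κ → B := fun k =>
    algebraMap R B ϖ * algebraMap R B ϖ * q00 k + ∑ j, algebraMap R B ϖ * g j * q0 k j + ∑ j, ∑ l, g j * g l * qq k j l with hQ2
  set v : Fin p → (F × (Fin r → S)) ⧸ P := fun i => P.mkQ (dividedVec R S t (f0 i) (fc i)) with hvdef
  set v' : κ → (F × (Fin r → S)) ⧸ P := fun k =>
    P.mkQ (twiceDividedVec R S t (q00 k) (q0 k) (qq k)) with hv'def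
  set T : Set F := Set.range fun f : I => (1 : S) ⊗ₜ[B] D R (B) (f : B) with hTdef
  have hTspan : Submodule.span S T = conormalSpan R (B) I S := rfl
  -- (E1)/(E2) in the quotient: `D (1 ⊗ dFᵢ) = π vᵢ`, `D (1 ⊗ dQₖ) = π² v'ₖ`
  have hDF1 : ∀ i, Dm ((1 : S) ⊗ₜ[B] D R (B) (F1 i)) = π • v i := by
    intro i
    have e := inl_tmul_D_eq ϖ S g t hgt (f0 i) (fc i)
    rw [dilatationMap_apply, hvdef]
    simp only
    rw [← map_smul, ← sub_eq_zero, ← map_sub, Submodule.mkQ_apply, Submodule.Quotient.mk_eq_zero, e,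
      sub_sub_cancel_left]
    exact neg_mem (Submodule.sum_mem _ fun j _ => Submodule.smul_mem _ _
      (single_mem_dilatationRelations γ π j))
  have hDQ2 : ∀ k, Dm ((1 : S) ⊗ₜ[B] D R (B) (Q2 k)) = (π * π) • v' k := by
    intro k
    have e := inl_tmul_D_eq₂ ϖ S g t hgt (q00 k) (q0 k) (qq k)
    rw [dilatationMap_apply, hv'def]
    simp only
    rw [← map_smul, ← sub_eq_zero, ← map_sub, Submodule.mkQ_apply, Submodule.Quotient.mk_eq_zero, e,
      sub_sub_cancel_left]
    exact neg_mem (Submodule.sum_mem _ fun j _ => Submodule.smul_mem _ _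
      (single_mem_dilatationRelations γ π j))
  have hF1T : ∀ i, (1 : S) ⊗ₜ[B] D R (B) (F1 i) ∈ Submodule.span S T :=
    fun i => Submodule.subset_span ⟨⟨F1 i, hf i⟩, rfl⟩
  have hQ2T : ∀ k, (1 : S) ⊗ₜ[B] D R (B) (Q2 k) ∈ Submodule.span S T :=
    fun k => Submodule.subset_span ⟨⟨Q2 k, hq k⟩, rfl⟩
  -- hypotheses of the torsion drop
  have h₁ : ∀ i, π • v i ∈ (Submodule.span S T).map Dm :=
    fun i => ⟨_, hF1T i, hDF1 i⟩
  have h₂ : ∀ x ∈ Set.range v', (π * π) • x ∈ (Submodule.span S T).map Dm := by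
    rintro _ ⟨k, rfl⟩
    exact ⟨_, hQ2T k, hDQ2 k⟩
  have hT : ∀ x ∈ T, ∃ y₁ ∈ Submodule.span S (Set.range v), ∃ y₂ ∈ Submodule.span S (Set.range v'),
      Dm x = π • y₁ + (π * π) • y₂ := by
    rintro _ ⟨⟨f, hfI⟩, rfl⟩
    obtain ⟨u, hu, hgenf⟩ := hgen f hfI
    obtain ⟨f₁, hf₁, f₂, hf₂, hf12⟩ := Submodule.mem_sup.mp hgenf
    obtain ⟨b, rfl⟩ := (Ideal.mem_span_range_iff_exists_fun).mp hf₁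
    obtain ⟨c, rfl⟩ := (Ideal.mem_span_range_iff_exists_fun).mp hf₂
    obtain ⟨w, hw⟩ := (hU u hu).exists_left_inv
    have hF10 : ∀ i, algebraMap (B) S (F1 i) = 0 := fun i => by
      rw [IsScalarTower.algebraMap_apply (B) (B ⧸ I) S, Ideal.Quotient.algebraMap_eq,
        Ideal.Quotient.eq_zero_iff_mem.mpr (hf i), map_zero]
    have hQ20 : ∀ k, algebraMap (B) S (Q2 k) = 0 := fun k => by
      rw [IsScalarTower.algebraMap_apply (B) (B ⧸ I) S, Ideal.Quotient.algebraMap_eq,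
        Ideal.Quotient.eq_zero_iff_mem.mpr (hq k), map_zero]
    have hf0 : algebraMap B S f = 0 := by
      rw [IsScalarTower.algebraMap_apply B (B ⧸ I) S, Ideal.Quotient.algebraMap_eq,
        Ideal.Quotient.eq_zero_iff_mem.mpr hfI, map_zero]
    -- `u(a) (1 ⊗ df) = 1 ⊗ d(u f) = Σ bᵢ(a) (1 ⊗ dFᵢ) + Σ c_k(a) (1 ⊗ dQ_k)`
    have key : algebraMap B S u • ((1 : S) ⊗ₜ[B] D R B f) =
        ∑ i, algebraMap B S (b i) • ((1 : S) ⊗ₜ[B] D R B (F1 i)) +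
          ∑ k, algebraMap B S (c k) • ((1 : S) ⊗ₜ[B] D R B (Q2 k)) := by
      have e := congrArg (fun x : B => (1 : S) ⊗ₜ[B] D R B x) hf12
      simp only [map_add, map_sum, Derivation.leibniz, TensorProduct.tmul_add,
        TensorProduct.tmul_sum, one_tmul_smul, hF10, hQ20, hf0, zero_smul, add_zero] at e
      exact e.symm
    have key' : (1 : S) ⊗ₜ[B] D R B f =
        w • (∑ i, algebraMap B S (b i) • ((1 : S) ⊗ₜ[B] D R B (F1 i)) +
          ∑ k, algebraMap B S (c k) • ((1 : S) ⊗ₜ[B] D R B (Q2 k))) := by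
      rw [← key, smul_smul, hw, one_smul]
    refine ⟨∑ i, (w * algebraMap B S (b i)) • v i,
      Submodule.sum_mem _ fun i _ => Submodule.smul_mem _ _ (Submodule.subset_span ⟨i, rfl⟩),
      ∑ k, (w * algebraMap B S (c k)) • v' k,
      Submodule.sum_mem _ fun k _ => Submodule.smul_mem _ _ (Submodule.subset_span ⟨k, rfl⟩), ?_⟩
    simp only [key', map_smul, map_add, map_sum, hDF1, hDQ2, Finset.smul_sum, smul_add, mul_smul,
      smul_comm π, smul_comm (π * π)]
  -- the torsion drop
  have hDinj : Function.Injective Dm := dilatationMap_injective γ (IsRegular.of_ne_zero hπ.ne_zero)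
  have hdrop := length_torsion_quotient_add_finrank_le_of_span hπ Dm hDinj
    (exists_dilatationMap_eq_smul γ π) T v (Set.range v') h₁ h₂ hT
  have hrankL' := finrank_span_sup_span_eq hπ Dm hDinj (Submodule.span S T) v (Set.range v') h₁ h₂
    (by
      intro x hx
      induction hx using Submodule.span_induction with
      | mem x hx => exact hT x hx
      | zero => exact ⟨0, zero_mem _, 0, zero_mem _, by simp⟩
      | add x y _ _ hx hy =>
        obtain ⟨x₁, hx₁, x₂, hx₂, ex⟩ := hx
        obtain ⟨y₁, hy₁, y₂, hy₂, ey⟩ := hy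
        exact ⟨x₁ + y₁, add_mem hx₁ hy₁, x₂ + y₂, add_mem hx₂ hy₂, by
          rw [map_add, ex, ey, smul_add, smul_add]; abel⟩
      | smul c x _ hx =>
        obtain ⟨x₁, hx₁, x₂, hx₂, ex⟩ := hx
        exact ⟨c • x₁, Submodule.smul_mem _ _ hx₁, c • x₂, Submodule.smul_mem _ _ hx₂, by
          rw [map_smul, ex, smul_add, smul_comm c π, smul_comm c (π * π)]⟩)
  set L' : Submodule S ((F × (Fin r → S)) ⧸ P) :=
    Submodule.span S (Set.range v) ⊔ Submodule.span S (Set.range v') with hL'def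
  -- `δ(a)` and the ranks on the `X` side
  have hδa : neronDefect R (B ⧸ I) S = Module.length S (Submodule.torsion S (F ⧸ Submodule.span S T)) :=
    neronDefect_quotient_eq R (B) I S
  have hN : Module.finrank S F = N := finrank_tensor_kaehler_eq S
  have hrankL : Module.finrank S (Submodule.span S T) + Module.finrank S (S ⊗[B ⧸ I] Ω[(B ⧸ I)⁄R]) = N := by
    rw [hTspan, finrank_conormalSpan_add R (B) I S, hN]
  -- `δ(a') ≤ ℓ(tors (F' ⧸ L'))` through `Ψ`
  have hPrel : P ≤ LinearMap.ker (PsiMap R I A' z S) := by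
    refine Submodule.span_le.mpr ?_
    rintro _ ⟨j, rfl⟩
    exact PsiMap_rel ϖ I A' g z hz S j
  set Ψq : ((F × (Fin r → S)) ⧸ P) →ₗ[S] S ⊗[A'] Ω[A'⁄R] := P.liftQ (PsiMap R I A' z S) hPrel
    with hΨq
  have hL'ker : L' ≤ LinearMap.ker Ψq := by
    refine sup_le (Submodule.span_le.mpr ?_) (Submodule.span_le.mpr ?_)
    · rintro _ ⟨i, rfl⟩
      rw [SetLike.mem_coe, LinearMap.mem_ker, hvdef]
      simp only
      rw [Submodule.mkQ_apply, hΨq, Submodule.liftQ_apply, PsiMap_dividedVec I A' z S,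
        dividedRel_eq_zero ϖ I A' g z hz hreg (f0 i) (fc i) (hf i), map_zero, TensorProduct.tmul_zero]
    · rintro _ ⟨k, rfl⟩
      rw [SetLike.mem_coe, LinearMap.mem_ker, hv'def]
      simp only
      rw [Submodule.mkQ_apply, hΨq, Submodule.liftQ_apply, PsiMap_twiceDividedVec I A' z S,
        twiceDividedRel_eq_zero ϖ I A' g z hz hreg (q00 k) (q0 k) (qq k) (hq k), map_zero,
        TensorProduct.tmul_zero]
  set Ψqq : (((F × (Fin r → S)) ⧸ P) ⧸ L') →ₗ[S] S ⊗[A'] Ω[A'⁄R] := L'.liftQ Ψq hL'ker with hΨqq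
  have hΨsurj : Function.Surjective Ψqq := by
    intro m
    obtain ⟨x, rfl⟩ := PsiMap_surjective I A' z S hadj m
    exact ⟨L'.mkQ (P.mkQ x), rfl⟩
  -- ranks on the `X'` side
  have hrankF' : Module.finrank S ((F × (Fin r → S)) ⧸ P) = N := by
    have h1 : Module.finrank S (LinearMap.range Dm) = Module.finrank S (⊤ : Submodule S ((F × (Fin r → S)) ⧸ P)) := by
      refine finrank_eq_of_le_of_torsion (LinearMap.range Dm) ⊤ le_top fun y _ => ?_
      obtain ⟨x, hx⟩ := exists_dilatationMap_eq_smul γ π y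
      exact ⟨π, mem_nonZeroDivisors_of_ne_zero hπ.ne_zero, x, hx⟩
    rw [← finrank_top, ← h1, ← (LinearEquiv.ofInjective Dm hDinj).finrank_eq, hN]
  have hrankQ : Module.finrank S (((F × (Fin r → S)) ⧸ P) ⧸ L') =
      Module.finrank S (S ⊗[A'] Ω[A'⁄R]) := by
    have h := Submodule.finrank_quotient_add_finrank L'
    rw [hrankL', hrankF'] at h
    -- `h : rank (F'/L') + rank L = N`, `hrankL : rank L + rank M = N`
    have h3 : Module.finrank S (((F × (Fin r → S)) ⧸ P) ⧸ L') + Module.finrank S (Submodule.span S T) =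
        Module.finrank S (S ⊗[B ⧸ I] Ω[(B ⧸ I)⁄R]) + Module.finrank S (Submodule.span S T) := by
      rw [h, add_comm, hrankL]
    exact (Nat.add_right_cancel h3).trans hrank
  have hδa' : neronDefect R A' S ≤
      Module.length S (Submodule.torsion S (((F × (Fin r → S)) ⧸ P) ⧸ L')) :=
    length_torsion_le_of_surjective_of_finrank_eq Ψqq hΨsurj hrankQ
  -- conclusion
  calc neronDefect R A' S + (N : ℕ∞)
      = neronDefect R A' S + Module.finrank S (Submodule.span S T) +
          Module.finrank S (S ⊗[B ⧸ I] Ω[(B ⧸ I)⁄R]) := by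
        rw [add_assoc, ← Nat.cast_add, hrankL]
    _ ≤ Module.length S (Submodule.torsion S (((F × (Fin r → S)) ⧸ P) ⧸ L')) +
          Module.finrank S (Submodule.span S T) + Module.finrank S (S ⊗[B ⧸ I] Ω[(B ⧸ I)⁄R]) :=
        add_le_add (add_le_add hδa' le_rfl) le_rfl
    _ ≤ Module.length S (Submodule.torsion S (F ⧸ Submodule.span S T)) + Fintype.card (Fin p) +
          Module.finrank S (S ⊗[B ⧸ I] Ω[(B ⧸ I)⁄R]) := add_le_add hdrop le_rfl
    _ = neronDefect R (B ⧸ I) S + p + Module.finrank S (S ⊗[B ⧸ I] Ω[(B ⧸ I)⁄R]) := by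
        rw [hδa, Fintype.card_fin]

end Assembly

/-! ### The polynomial case -/

section MvPolynomialCase

variable {R : Type u} [CommRing R] (ϖ : R) {N : ℕ} (I : Ideal (MvPolynomial (Fin N) R))
  (A' : Type u) [CommRing A'] [Algebra R A'] [Algebra (MvPolynomial (Fin N) R ⧸ I) A']
  [IsScalarTower R (MvPolynomial (Fin N) R ⧸ I) A']
  {r : ℕ} (g : Fin r → MvPolynomial (Fin N) R) (z : Fin r → A')
  (hz : ∀ j, algebraMap R A' ϖ * z j =
    algebraMap (MvPolynomial (Fin N) R ⧸ I) A' (Ideal.Quotient.mk I (g j)))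
  (S : Type u) [CommRing S] [IsDomain S] [IsDiscreteValuationRing S] [Algebra R S]
  [Algebra (MvPolynomial (Fin N) R) S]
  [Algebra (MvPolynomial (Fin N) R ⧸ I) S] [Algebra A' S]
  [IsScalarTower R (MvPolynomial (Fin N) R) S]
  [IsScalarTower (MvPolynomial (Fin N) R) (MvPolynomial (Fin N) R ⧸ I) S]
  [IsScalarTower R (MvPolynomial (Fin N) R ⧸ I) S]
  [IsScalarTower (MvPolynomial (Fin N) R ⧸ I) A' S] [IsScalarTower R A' S]

include hz in
/-- **BLR Prop. 3.3/5 (pointwise, from generator data)** for `B = R[T₁, …, T_N]`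
(`neronDefect_dilatation_add_finrank_le` with `rank_B Ω[B⁄R] = N`). [cite: Artin1986NeronModels, Lemma (3.9) (p. 227)] -/
theorem neronDefect_dilatation_add_le (hπ : Irreducible (algebraMap R S ϖ))
    (hreg : IsSMulRegular A' (algebraMap R A' ϖ))
    (hadj : Algebra.adjoin (MvPolynomial (Fin N) R ⧸ I) (Set.range z) = ⊤)
    (hrank : Module.finrank S (S ⊗[MvPolynomial (Fin N) R ⧸ I] Ω[(MvPolynomial (Fin N) R ⧸ I)⁄R]) = Module.finrank S (S ⊗[A'] Ω[A'⁄R]))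
    (hγ : ∀ c : Fin r → S, (∃ y : S ⊗[MvPolynomial (Fin N) R] Ω[MvPolynomial (Fin N) R⁄R], ∑ j, c j • centreVec S g j = algebraMap R S ϖ • y) →
      ∀ j, algebraMap R S ϖ ∣ c j)
    {p : ℕ} (f0 : Fin p → MvPolynomial (Fin N) R) (fc : Fin p → Fin r → MvPolynomial (Fin N) R)
    (hf : ∀ i, C ϖ * f0 i + ∑ j, g j * fc i j ∈ I)
    {κ : Type} [Fintype κ] (q00 : κ → MvPolynomial (Fin N) R) (q0 : κ → Fin r → MvPolynomial (Fin N) R) (qq : κ → Fin r → Fin r → MvPolynomial (Fin N) R)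
    (hq : ∀ k, C ϖ * C ϖ * q00 k + ∑ j, C ϖ * g j * q0 k j + ∑ j, ∑ l, g j * g l * qq k j l ∈ I)
    (hgen : I ≤ Ideal.span (Set.range fun i => C ϖ * f0 i + ∑ j, g j * fc i j) ⊔
      Ideal.span (Set.range fun k =>
        C ϖ * C ϖ * q00 k + ∑ j, C ϖ * g j * q0 k j + ∑ j, ∑ l, g j * g l * qq k j l)) :
    neronDefect R A' S + N ≤
      neronDefect R (MvPolynomial (Fin N) R ⧸ I) S + p + Module.finrank S (S ⊗[MvPolynomial (Fin N) R ⧸ I] Ω[(MvPolynomial (Fin N) R ⧸ I)⁄R]) := by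
  haveI : Nontrivial R := (algebraMap R S).domain_nontrivial
  haveI : Module.Free (MvPolynomial (Fin N) R) Ω[MvPolynomial (Fin N) R⁄R] :=
    Module.Free.of_basis (KaehlerDifferential.mvPolynomialBasis R (Fin N))
  have hNf : Module.finrank (MvPolynomial (Fin N) R) Ω[MvPolynomial (Fin N) R⁄R] = N := by
    rw [Module.finrank_eq_card_basis (KaehlerDifferential.mvPolynomialBasis R (Fin N)),
      Fintype.card_fin]
  have h := neronDefect_dilatation_add_finrank_le ϖ I A' g z hz S hπ hreg hadj hrank hγ f0 fc hf
    q00 q0 qq hq ⊥ (fun u hu => by rw [Submonoid.mem_bot] at hu; rw [hu, map_one]; exact isUnit_one)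
    (fun f hf' => ⟨1, Submonoid.one_mem _, by rw [one_mul]; exact hgen hf'⟩)
  rwa [hNf] at h

end MvPolynomialCase

/-! ### The centre ideal and the density lemma (ring form)

If the exceptional fibre of the dilatation is schematically dense over the centre, i.e.
`A/𝔟 → A'/(ϖ)` is injective, then an equation of `X` whose linear part along the centre
vanishes, `f = ϖ f₀ + Σ gⱼ yⱼ ∈ I` with `yⱼ ∈ 𝔟̃ = (ϖ, g)`, has `f₀ ∈ 𝔟̃` — so `f ∈ 𝔟̃²` is an
equation "divisible twice by `ϖ`" on the dilatation (BLR, proof of Prop. 3.3/5; Artin (3.12):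
"`f(0, y) ≡ 0 (mod p²)` for all `y`, i.e., identically"). -/

section Density

variable {R : Type u} [CommRing R] (ϖ : R) {B : Type u} [CommRing B] [Algebra R B]
  (I : Ideal B)
  (A' : Type u) [CommRing A'] [Algebra R A'] [Algebra (B ⧸ I) A']
  [IsScalarTower R (B ⧸ I) A']
  {r : ℕ} (g : Fin r → B) (z : Fin r → A')
  (hz : ∀ j, algebraMap R A' ϖ * z j =
    algebraMap (B ⧸ I) A' (Ideal.Quotient.mk I (g j)))

/-- **The centre ideal `𝔟 = (ϖ, ḡ₁, …, ḡ_r) ⊆ A = R[T]/I`** (the centre of the dilatation is the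
closed subscheme `V(𝔟)` of the special fibre `V(ϖ)` of `X = Spec A`). [folklore] -/
def centreIdeal : Ideal (B ⧸ I) :=
  Ideal.span (insert (algebraMap R (B ⧸ I) ϖ)
    (Set.range fun j => Ideal.Quotient.mk I (g j)))

/-- The lifted centre ideal `𝔟̃ = (ϖ, g₁, …, g_r) ⊆ B = R[T]`. [folklore] -/
def centreIdealB : Ideal (B) :=
  Ideal.span (insert (algebraMap R B ϖ) (Set.range g))

/-- `ϖ ∈ 𝔟`. [folklore] -/
theorem algebraMap_mem_centreIdeal :
    algebraMap R (B ⧸ I) ϖ ∈ centreIdeal ϖ I g :=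
  Ideal.subset_span (Set.mem_insert _ _)

/-- `ḡⱼ ∈ 𝔟`. [folklore] -/
theorem mk_mem_centreIdeal (j : Fin r) : Ideal.Quotient.mk I (g j) ∈ centreIdeal ϖ I g :=
  Ideal.subset_span (Set.mem_insert_of_mem _ ⟨j, rfl⟩)

/-- `𝔟̃` maps onto `𝔟`. [folklore] -/
theorem map_centreIdealB :
    (centreIdealB ϖ g).map (Ideal.Quotient.mk I) = centreIdeal ϖ I g := by
  rw [centreIdealB, centreIdeal, Ideal.map_span, Set.image_insert_eq, ← Set.range_comp]
  congr 2

include hz in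
/-- **The density lemma (ring form).** Let `A'` be an `A`-algebra with `ϖ zⱼ = ḡⱼ`, `ϖ` regular,
and `𝔟 A' ⊆ (ϖ)` (the dilatation). If `A/𝔟 → A'/(ϖ)` is injective (the exceptional fibre is
schematically dense over the centre) and `I ⊆ 𝔟̃`, then for `f = ϖ f₀ + Σ gⱼ yⱼ ∈ I` with
`yⱼ ∈ 𝔟̃` one has `f₀ ∈ 𝔟̃`: on `A'`, `0 = f = ϖ (f₀ + ϖ Σ zⱼ wⱼ)` with `yⱼ = ϖ wⱼ`, so `f₀ ≡ 0`
modulo `(ϖ)` on `A'`, hence `f₀ ≡ 0` modulo `𝔟` on `A`.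
[cite: Artin1986NeronModels, proof of Lemma (3.9), step (e), (3.12) (p. 227)] -/
theorem mem_centreIdealB_of_injective (hreg : IsSMulRegular A' (algebraMap R A' ϖ))
    (hmap : (centreIdeal ϖ I g).map (algebraMap (B ⧸ I) A') ≤
      Ideal.span {algebraMap R A' ϖ})
    (hinj : Function.Injective (Ideal.quotientMap (Ideal.span {algebraMap R A' ϖ})
      (algebraMap (B ⧸ I) A') (Ideal.map_le_iff_le_comap.mp hmap)))
    (hI : I ≤ centreIdealB ϖ g) {f0 : B}
    {y : Fin r → B} (hy : ∀ j, y j ∈ centreIdealB ϖ g)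
    (hf : algebraMap R B ϖ * f0 + ∑ j, g j * y j ∈ I) :
    f0 ∈ centreIdealB ϖ g := by
  classical
  -- `yⱼ = ϖ wⱼ` on `A'`
  have hyw : ∀ j, ∃ w : A', toDil R I A' (y j) = algebraMap R A' ϖ * w := by
    intro j
    have h1 : toDil R I A' (y j) ∈ (centreIdeal ϖ I g).map (algebraMap (B ⧸ I) A') := by
      rw [toDil_apply]
      refine Ideal.mem_map_of_mem _ ?_
      rw [← map_centreIdealB]
      exact Ideal.mem_map_of_mem _ (hy j)
    obtain ⟨w, hw⟩ := Ideal.mem_span_singleton'.mp (hmap h1)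
    exact ⟨w, by rw [← hw, mul_comm]⟩
  choose w hw using hyw
  -- `0 = f = ϖ (f₀ + ϖ Σ zⱼ wⱼ)` on `A'`
  have hexp : toDil R I A' (algebraMap R B ϖ * f0 + ∑ j, g j * y j) =
      algebraMap R A' ϖ * (toDil R I A' f0 + algebraMap R A' ϖ * ∑ j, z j * w j) := by
    rw [map_add, map_sum, map_mul, toDil_algebraMap, mul_add, Finset.mul_sum, Finset.mul_sum]
    congr 1
    refine Finset.sum_congr rfl fun j _ => ?_
    rw [map_mul, toDil_g ϖ I A' g z hz, hw]
    ring
  have hzero : toDil R I A' f0 + algebraMap R A' ϖ * ∑ j, z j * w j = 0 := by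
    apply hreg
    change algebraMap R A' ϖ * (toDil R I A' f0 + algebraMap R A' ϖ * ∑ j, z j * w j) =
      algebraMap R A' ϖ * 0
    rw [mul_zero, ← hexp, toDil_eq_zero I A' hf]
  -- hence `f₀ ≡ 0` modulo `(ϖ)` on `A'`, and by injectivity modulo `𝔟` on `A`
  have hf0 : Ideal.Quotient.mk (centreIdeal ϖ I g) (Ideal.Quotient.mk I f0) = 0 := by
    apply hinj
    rw [map_zero, Ideal.quotientMap_mk, Ideal.Quotient.eq_zero_iff_mem,
      Ideal.mem_span_singleton']
    refine ⟨-(∑ j, z j * w j), ?_⟩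
    rw [← toDil_apply (R := R), eq_neg_of_add_eq_zero_left hzero]
    ring
  rw [Ideal.Quotient.eq_zero_iff_mem, ← map_centreIdealB,
    Ideal.mem_map_iff_of_surjective _ Ideal.Quotient.mk_surjective] at hf0
  obtain ⟨f1, hf1, hf01⟩ := hf0
  rw [Ideal.Quotient.eq] at hf01
  have hdiff : f0 - f1 ∈ centreIdealB ϖ g := by
    rw [← neg_sub]
    exact neg_mem (hI hf01)
  simpa using add_mem hf1 hdiff

end Density

end Literature.AlgebraicGeometry.Smoothening
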